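/-
Copyright (c) 2026 the pub-hodgecm-mathlib formalisation cell (harness21).  Prover seat hodgecm-mathlib-LH4-p12 (g7), req620 Track A «(D-RAM) FOUR-FRAME» squad
(dealer LH4-plan (g12) WORD #39 «(L-sq)-SIG»; heir LEAD F0P3a-plan (g20) T19-24); helper lane `--supports stmt-HodgeConjecture-24833`.  2026-09-04.
-/
import Summits.HodgeConjecture.HodgeConjecture.Theorems.F0P3cDyRamFrameEltLevelAlgebra    -- ★ p858722 (this seat): `ncard_sqLevel_add_regFixCount_eq_fixedVertexCount`; brings ★ census DEFS `regFixCount`, `LatticeInLevel`, ★ #0a `fixedVertexCount`, `kappaChar`, `ampl`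
import HarnessLib

/-!
# Crux `H413`, line LH4 «(D-RAM) FOUR-FRAME» road — THE REGULAR-PIECE CENSUS IS THE UNIT CENSUS MINUS THE SQUARE-LEVEL CENSUS, frame by frame and in the κ-signed ∕ stable
# four-frame sums: the bookkeeping that reduces the regular row's G-side law to the square-level law

Cell `hodgecm-mathlib` (D-0151), FLOOR 0, crux item H413 = `stmt-HodgeConjecture-24833`, route of record `HCCMUnconditional`; squad F0∕P3c∕LH4 (req618∕req620).
THEOREMS ONLY (no `def`, no instance, no notation, no `sorry`, default heartbeats); lane `--supports stmt-HodgeConjecture-24833 --as helper` (count-neutral).  A STAGE-1b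
PRE-BRICK (T19-24 clause; the §3 «REDUCTION» of the signature sheet `F0/P3c/LH4/LH4-p12/g7/SIG-L-sq.v1.LH4p12g7.md`, DEF-FREE: the square-level count is written as the ★ set-builder
of ★ p858704 ∕ ★ p858722, so no DEFS leaf is presupposed).  The regular profile piece of the tier-0 row `stub_rows_regular` is `f_reg = 1_K − sq_{m*}` (★ p858649
`pieceReg_eq_unit0_sub`); on the census side ★ p858722 `ncard_sqLevel_add_regFixCount_eq_fixedVertexCount` says `#{square-level fixed} + regFixCount = fixedVertexCount 0` on a finite
fixed set.  This file rearranges that split in `ℤ` and pushes it through the four-frame sums the law Props read: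

* `regFixCount_eq_sub` — `regFixCount σ ϖ m T = fixedVertexCount σ ϖ 0 T − #{M type-0 | T·M = M ∧ (T−1)²·M ⊆ ϖ^m·M}` in `ℤ`;
* `kappaSum_regFixCount_eq_sub`, `sum_regFixCount_eq_sub` — the κ-signed and the stable four-frame sums of the regular count are the unit's minus the square-level's;
* `kappaSum_regFixCount_eq_of_unit_of_sq`, `sum_regFixCount_eq_of_unit_of_sq` — hence, GIVEN the unit sums and the square-level sums in closed form with a common sign token (the shape of
  ★ №1-R2 `KappaSignLawAtS2` ∕ ★ №1 `StableLawAt` and of the square-level targets of the signature sheet), the regular sums are the DIFFERENCES of the two closed forms — so a STAGE-1b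
  producer proves ONE new census law (square-level) and the regular piece's law follows with no further census.

The finiteness hypothesis `hfin` (finite fixed type-0 vertex set of each literal) is discharged at a wild datum by ★ `finite_setOf_latticeGraphIso_eq_of_frameElt` ∕
★ `finite_setOf_isVertexLattice_mapGL_diagonal_eq`; it is carried, not re-proved, here.

HONEST LABEL.  Count-neutral helper: states no law, pays no stub; the three tier-0 rows stay OPEN; `HC_CM` is proved only modulo the 7 printed citations (2 remaining named inputs:
hLiu418 = `stmt-HodgeConjecture-24832`, h413 = `stmt-HodgeConjecture-24833`) until rung 0 closes.

## References
* [Kottwitz1986BaseChangeUnits] R. E. Kottwitz, *Base change for unit elements of Hecke algebras*, Compositio Math. 60 (1986), §1 pp. 240–241 (orbital integrals of units as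
  fixed-lattice counts of a torus element).
* [Rogawski1990] J. D. Rogawski, *Automorphic Representations of Unitary Groups in Three Variables*, Ann. of Math. Stud. 123 (1990), §4.9 Prop. 4.9.1 (b) p. 55.
* [LanglandsShelstad1987] R. P. Langlands, D. Shelstad, *On the definition of transfer factors*, Math. Ann. 278 (1987), §1.3 (the κ-signs of the classes in a stable class).
-/

set_option autoImplicit false

noncomputable section

namespace Summit.HodgeConjecture.HodgeConjecture.Cruxes.H413.F0P3cDyRamRegCensusOfSqCensus

open Literature.NumberTheory.Automorphic Literature.NumberTheory.Automorphic.UnitaryLatticeTree Literature.NumberTheory.Automorphic.HermitianLattice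
open Literature.NumberTheory.Automorphic.UnitaryThreeFourFrame
open Summit.HodgeConjecture.HodgeConjecture.Cruxes.H413.F0P3cDyRamFourFrameCensusDefs
open Summit.HodgeConjecture.HodgeConjecture.Cruxes.H413.F0P3cDyRamFrameEltLevelAlgebra
open scoped Matrix MatrixGroups Valued WithZero

variable {K : Type} [Field K] [Valued K ℤᵐ⁰]

/-- **`regFixCount = fixedVertexCount 0 − #{square-level fixed}`** in `ℤ`, on a finite fixed type-0 vertex set (★ p858722's split, rearranged).
[cite: Kottwitz1986BaseChangeUnits, §1 pp. 240–241] [cite: Rogawski1990, §4.9 Prop. 4.9.1 (b) p. 55] -/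
theorem regFixCount_eq_sub (σ : K →+* K) (ϖ : K) (m : ℕ) (T : GL (Fin 3) K)
    (hfin : {M : Submodule 𝒪[K] (Fin 3 → K) | IsVertexLattice σ ϖ ((StdForm.antidiagonal 3).over K) 0 M ∧ mapGL T M = M}.Finite) :
    (regFixCount σ ϖ m T : ℤ) = (fixedVertexCount σ ϖ 0 T : ℤ) -
      ({M : Submodule 𝒪[K] (Fin 3 → K) | IsVertexLattice σ ϖ ((StdForm.antidiagonal 3).over K) 0 M ∧ mapGL T M = M ∧
          LatticeInLevel ϖ m (((T : Matrix (Fin 3) (Fin 3) K) - 1) * ((T : Matrix (Fin 3) (Fin 3) K) - 1)) M}.ncard : ℤ) := by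
  have h := ncard_sqLevel_add_regFixCount_eq_fixedVertexCount σ ϖ m T hfin
  rw [eq_sub_iff_add_eq, ← Nat.cast_add, add_comm]
  exact congrArg Nat.cast h

/-- **THE κ-SIGNED FOUR-FRAME SUM OF THE REGULAR COUNT = THE UNIT'S MINUS THE SQUARE-LEVEL'S** (finite fixed sets). [cite: LanglandsShelstad1987, §1.3] [cite: Rogawski1990, §4.9 Prop. 4.9.1 (b) p. 55] -/
theorem kappaSum_regFixCount_eq_sub (σ : K →+* K) (ϖ : K) (m : ℕ) (Γ : Fin 4 → GL (Fin 3) K)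
    (hfin : ∀ b, {M : Submodule 𝒪[K] (Fin 3 → K) | IsVertexLattice σ ϖ ((StdForm.antidiagonal 3).over K) 0 M ∧ mapGL (Γ b) M = M}.Finite) (i : Fin 3) :
    (∑ b : Fin 4, kappaChar i b * (regFixCount σ ϖ m (Γ b) : ℤ)) =
      (∑ b : Fin 4, kappaChar i b * (fixedVertexCount σ ϖ 0 (Γ b) : ℤ)) -
        ∑ b : Fin 4, kappaChar i b *
          ({M : Submodule 𝒪[K] (Fin 3 → K) | IsVertexLattice σ ϖ ((StdForm.antidiagonal 3).over K) 0 M ∧ mapGL (Γ b) M = M ∧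
              LatticeInLevel ϖ m (((Γ b : Matrix (Fin 3) (Fin 3) K) - 1) * ((Γ b : Matrix (Fin 3) (Fin 3) K) - 1)) M}.ncard : ℤ) := by
  rw [← Finset.sum_sub_distrib]
  refine Finset.sum_congr rfl fun b _ => ?_
  rw [regFixCount_eq_sub σ ϖ m (Γ b) (hfin b), mul_sub]

/-- **THE STABLE FOUR-FRAME SUM OF THE REGULAR COUNT = THE UNIT'S MINUS THE SQUARE-LEVEL'S** (finite fixed sets). [cite: Rogawski1990, §4.9 Prop. 4.9.1 (b) p. 55] -/
theorem sum_regFixCount_eq_sub (σ : K →+* K) (ϖ : K) (m : ℕ) (Γ : Fin 4 → GL (Fin 3) K)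
    (hfin : ∀ b, {M : Submodule 𝒪[K] (Fin 3 → K) | IsVertexLattice σ ϖ ((StdForm.antidiagonal 3).over K) 0 M ∧ mapGL (Γ b) M = M}.Finite) :
    (∑ b : Fin 4, (regFixCount σ ϖ m (Γ b) : ℤ)) =
      (∑ b : Fin 4, (fixedVertexCount σ ϖ 0 (Γ b) : ℤ)) -
        ∑ b : Fin 4, ({M : Submodule 𝒪[K] (Fin 3 → K) | IsVertexLattice σ ϖ ((StdForm.antidiagonal 3).over K) 0 M ∧ mapGL (Γ b) M = M ∧
            LatticeInLevel ϖ m (((Γ b : Matrix (Fin 3) (Fin 3) K) - 1) * ((Γ b : Matrix (Fin 3) (Fin 3) K) - 1)) M}.ncard : ℤ) := by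
  rw [← Finset.sum_sub_distrib]
  exact Finset.sum_congr rfl fun b _ => regFixCount_eq_sub σ ϖ m (Γ b) (hfin b)

/-- **THE REGULAR κ-LAW FOLLOWS FROM THE UNIT κ-LAW AND THE SQUARE-LEVEL κ-LAW**, frame family by frame family: if the unit's κ-signed sum is `S·ampl q k B` and the square-level's is
`S·ampl q k′ B′` (common sign token `S`; the shape of ★ №1-R2 `KappaSignLawAtS2` and of the square-level target of the signature sheet), then the regular's is `S·(ampl q k B − ampl q k′ B′)`.
[cite: LanglandsShelstad1987, §1.3] [cite: Rogawski1990, §4.9 Prop. 4.9.1 (b) p. 55] -/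
theorem kappaSum_regFixCount_eq_of_unit_of_sq (σ : K →+* K) (ϖ : K) (m : ℕ) (Γ : Fin 4 → GL (Fin 3) K)
    (hfin : ∀ b, {M : Submodule 𝒪[K] (Fin 3 → K) | IsVertexLattice σ ϖ ((StdForm.antidiagonal 3).over K) 0 M ∧ mapGL (Γ b) M = M}.Finite) (i : Fin 3)
    (S : ℤ) (q k k' : ℕ) (B B' : ℤ)
    (hunit : ((∑ b : Fin 4, kappaChar i b * (fixedVertexCount σ ϖ 0 (Γ b) : ℤ) : ℤ) : ℚ) = (S : ℚ) * ampl q k B)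
    (hsq : ((∑ b : Fin 4, kappaChar i b *
        ({M : Submodule 𝒪[K] (Fin 3 → K) | IsVertexLattice σ ϖ ((StdForm.antidiagonal 3).over K) 0 M ∧ mapGL (Γ b) M = M ∧
            LatticeInLevel ϖ m (((Γ b : Matrix (Fin 3) (Fin 3) K) - 1) * ((Γ b : Matrix (Fin 3) (Fin 3) K) - 1)) M}.ncard : ℤ) : ℤ) : ℚ) = (S : ℚ) * ampl q k' B') :
    ((∑ b : Fin 4, kappaChar i b * (regFixCount σ ϖ m (Γ b) : ℤ) : ℤ) : ℚ) = (S : ℚ) * (ampl q k B - ampl q k' B') := by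
  rw [kappaSum_regFixCount_eq_sub σ ϖ m Γ hfin i, Int.cast_sub, hunit, hsq, mul_sub]

/-- **THE REGULAR STABLE LAW FOLLOWS FROM THE UNIT STABLE LAW AND THE SQUARE-LEVEL STABLE LAW**: if `Σ_b n₀(Γ_b) = 4(q^k − 1)∕(q − 1)` and `Σ_b sq(Γ_b) = 4(q^{k′} − 1)∕(q − 1)` then
`Σ_b regFixCount(Γ_b) = 4(q^k − q^{k′})∕(q − 1)` (the shape of ★ №1 `StableLawAt` and of the square-level stable target). [cite: Rogawski1990, §4.9 Prop. 4.9.1 (b) p. 55] -/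
theorem sum_regFixCount_eq_of_unit_of_sq (σ : K →+* K) (ϖ : K) (m : ℕ) (Γ : Fin 4 → GL (Fin 3) K)
    (hfin : ∀ b, {M : Submodule 𝒪[K] (Fin 3 → K) | IsVertexLattice σ ϖ ((StdForm.antidiagonal 3).over K) 0 M ∧ mapGL (Γ b) M = M}.Finite)
    (q : ℚ) (k k' : ℕ)
    (hunit : ((∑ b : Fin 4, fixedVertexCount σ ϖ 0 (Γ b) : ℕ) : ℚ) = 4 * (q ^ k - 1) / (q - 1))
    (hsq : ((∑ b : Fin 4, {M : Submodule 𝒪[K] (Fin 3 → K) | IsVertexLattice σ ϖ ((StdForm.antidiagonal 3).over K) 0 M ∧ mapGL (Γ b) M = M ∧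
        LatticeInLevel ϖ m (((Γ b : Matrix (Fin 3) (Fin 3) K) - 1) * ((Γ b : Matrix (Fin 3) (Fin 3) K) - 1)) M}.ncard : ℕ) : ℚ) = 4 * (q ^ k' - 1) / (q - 1)) :
    ((∑ b : Fin 4, regFixCount σ ϖ m (Γ b) : ℕ) : ℚ) = 4 * (q ^ k - q ^ k') / (q - 1) := by
  have h := sum_regFixCount_eq_sub σ ϖ m Γ hfin
  have hcast : ((∑ b : Fin 4, regFixCount σ ϖ m (Γ b) : ℕ) : ℚ) =
      ((∑ b : Fin 4, fixedVertexCount σ ϖ 0 (Γ b) : ℕ) : ℚ) -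
        ((∑ b : Fin 4, {M : Submodule 𝒪[K] (Fin 3 → K) | IsVertexLattice σ ϖ ((StdForm.antidiagonal 3).over K) 0 M ∧ mapGL (Γ b) M = M ∧
            LatticeInLevel ϖ m (((Γ b : Matrix (Fin 3) (Fin 3) K) - 1) * ((Γ b : Matrix (Fin 3) (Fin 3) K) - 1)) M}.ncard : ℕ) : ℚ) := by
    have h' := congrArg (fun z : ℤ => (z : ℚ)) h
    push_cast at h' ⊢
    exact h'
  rw [hcast, hunit, hsq, div_sub_div_same]
  ring
end Summit.HodgeConjecture.HodgeConjecture.Cruxes.H413.F0P3cDyRamRegCensusOfSqCensus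

end
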